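import Summits.BirchSwinnertonDyer.BirchSwinnertonDyer.Theorems.CumulativeHeegnerLeopoldtLeopoldtKernelAtThree
import Summits.BirchSwinnertonDyer.BirchSwinnertonDyer.Theorems.CumulativeHeegnerLeopoldtCumulativeHeegnerInclusionAtThreeMuHalfOfResidualFinite
import Summits.BirchSwinnertonDyer.BirchSwinnertonDyer.Theorems.CumulativeHeegnerLeopoldtCumulativeHeegnerInclusionAtThreeStubThreeSaturation
import Summits.BirchSwinnertonDyer.BirchSwinnertonDyer.Theorems.CumulativeHeegnerLeopoldtEisensteinCharacterInvariantsAtThreeCharacterCutEq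
import Summits.BirchSwinnertonDyer.BirchSwinnertonDyer.Theorems.CumulativeHeegnerLeopoldtEisensteinCharacterInvariantsAtThreeLocThree
import Summits.BirchSwinnertonDyer.BirchSwinnertonDyer.Theorems.CumulativeHeegnerLeopoldtRedSplitControlAtThreeProof
import Literature.NumberTheory.EllipticCurves.CastellaGrossiLeeSkinner2022.KatzPAdicLFunctionExistence
import HarnessLib

/-!
# Route `CumulativeHeegnerLeopoldt` (rev 6): the kernel♯ with K2 AT ODD `d_K` ONLY, and the W-ALL leaf from the route's
# residual content AFTER the character cut of K2 — kernel-checked census (lead prover bsd-line-chl-p1 g9; HELPER,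
# `--supports 24199`)

Two theorems, both CONDITIONAL on every displayed hypothesis (nothing is asserted about any of them; no item is
credited; BSD is not proved for any curve by any of this):

* §1 `leopoldtKernelAtThree_of_not_hasCM_of_frameOdd_of_oddK2` — the kernel♯ `leopoldtKernelAtThree_of_not_hasCM_of_frameOdd`
  (Theorems/…LeopoldtKernelAtThreeOfPrint.lean) re-run VERBATIM with the crux K2 `EisensteinCharacterInvariantsAtThree`
  WEAKENED to K2_odd (the same text with `Odd (NumberField.discr K) →` inserted after the Heegner hypothesis): ONE token
  changes (the kernel applies K2 only at its Friedberg–Hoffstein field, after deriving `Odd (discr K)` from the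
  auxiliary splitting of `2`). KERNEL-CHECKED RESTATE DATUM for the pen: restating item 24199 with that binder costs the
  route's deciding chain nothing (and deletes the K2 line's scope-residue stub `stub_evenDiscriminant`).
* §2 `wAllExclAddWildRankOne_of_characterCut` — the W-ALL leaf `WAllExclAddWildRankOne` from EXACTLY: the three print
  packages (`ToricPublishedInputs` 20389-glue ✓, `LiuZhangZhangAdditiveInput` 20316, `WildSplitPrintedInputsAtThree`
  24476), crux A = `TemperedHeegnerInclusionAtThree` (26896, K1's research stub), the print fact CGLS22 Prop. 14 (item
  26897; gives B1 hence K1's μ-half and K2's algebraic side), the K2 line v2 stubs [ALG] `stub_algLambda`, [AN]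
  `stub_anCongruence` (research), [BRram] `stub_ramifiedBranch`, [BR𝟙] `CharMainConjOnTree 3`, [F1b]
  `CastellaGrossiLeeSkinner2022.thm212_exists_isKatzLFunction` (print), the rank-zero partner K5 and the off-cell residual
  K6 (plus `hS` = UTD 24475, itself a tree theorem p596578, displayed only for build hygiene) — with K4
  `RedSplitControlAtThree` now a THEOREM (`RedSplitControlAtThreeOfFacts.redSplitControlAtThree_proof`),
  [TOR] (p681358) and [LOC₃] (p682321) theorems, the character cut p681722 and the kernel♯ of §1. Compared with g7's
  census `wAllExclAddWildRankOne_of_residualContent` (p611195: print → PT1 → PT2 → A → B1 → K2′ → K5 → K6): PT1/PT2 are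
  gone (K4 proved), B1 is replaced by its print input, and K2′ (monolithic research) by the five character-level
  statements of which exactly ONE ([AN]) is unprinted.

References: [CastellaGrossiLeeSkinner2022] Prop. 14, Thms. 1.2.2, 1.5.1, 2.1.2, 2.2.1–2.2.4, 3.2.1;
[JetchevSkinnerWan2017] §7.4.1; [FriedbergHoffstein1995] Thm. B; [LiuZhangZhang2018] Thms. 1.5.1/1.5.3.
-/

noncomputable section

open scoped Classical

set_option linter.dupNamespace false
set_option autoImplicit false

namespace Summit.BirchSwinnertonDyer.BirchSwinnertonDyer.Theorems

open WeierstrassCurve NumberField IsDedekindDomain Field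
  Literature.NumberTheory.EllipticCurves
  Literature.NumberTheory.EllipticCurves.ModularForms
  Literature.NumberTheory.EllipticCurves.LiuZhangZhang2018
  Literature.NumberTheory.EllipticCurves.Rank1Residual
  Literature.NumberTheory.EllipticCurves.KrizLi2019
  Summit.BirchSwinnertonDyer.Rank1Residual
  Summit.BirchSwinnertonDyer.Rank1Residual.Additive
  Summit.BirchSwinnertonDyer.Rank1Residual.X11b
  Summit.BirchSwinnertonDyer.Rank1Residual.X11b.AcSelmer
  Summit.BirchSwinnertonDyer.Rank1Residual.X11b.Halves
  Summit.BirchSwinnertonDyer.BirchSwinnertonDyer.Theses.CumulativeHeegnerLeopoldt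
  -- the currency of the character-cut binder types (p614352 / p681722)
  Literature.NumberTheory.EllipticCurves.KellerYin2024
  Literature.NumberTheory.GaloisRepresentations
  Summit.BirchSwinnertonDyer.Rank1Residual.X1.KellerYinMuLambdaSplit

/-! ## §1 The kernel♯ with K2 weakened to odd `d_K` -/

/-- **Kernel♯ on the Leopoldt cell with K2 at ODD `d_K` only.** Published inputs → `LiuZhangZhangAdditiveInput` → K1 →
K2_odd → `UTD.WildSplitPrintedInputsAtThree` → `UTD.WildSplitFrameAtThreeOddOfPrint` → K4 → K5 ⟹ `BSD₃(E)` for every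
globally minimal NON-CM `E/ℚ` on `ClassO6 W 3` with `r_an = 1`, `E[3]` reducible and a non-anomalous rational line.
The proof is `leopoldtKernelAtThree_of_not_hasCM_of_frameOdd` token for token except that K2 is fed the kernel's own
`hodd : Odd (NumberField.discr K)` (Friedberg–Hoffstein with `2` split ⇒ `d_K ≡ 1 (mod 8)`). CONDITIONAL on every
displayed hypothesis; closes nothing by itself.
[cite: JetchevSkinnerWan2017, §7.4.1 (arXiv:1512.06894 p. 30)] [cite: FriedbergHoffstein1995, Thm. B]
[cite: LiuZhangZhang2018, Thm 1.5.1 and Thm 1.5.3] -/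
theorem leopoldtKernelAtThree_of_not_hasCM_of_frameOdd_of_oddK2 (hF : ToricPublishedInputs) (hL : LiuZhangZhangAdditiveInput)
    (h1 : CumulativeHeegnerInclusionAtThree)
    (h2 : ∀ (W : WeierstrassCurve ℚ) [W.IsElliptic] [W.IsGloballyMinimal] (N : ℕ) [NeZero N] (K : Type) [Field K] [NumberField K] (Dt : Literature.NumberTheory.EllipticCurves.ModularForms.ModularParametrizationData W N), Summit.BirchSwinnertonDyer.Rank1Residual.Additive.ClassO6 W 3 → Literature.NumberTheory.EllipticCurves.Rank1Residual.Red W 3 → (∃ Φ : AddSubgroup (WeierstrassCurve.geomTorsion W ((3 : ℕ) : ℤ)), Literature.NumberTheory.EllipticCurves.Rank1Residual.IsRationalLine W 3 Φ ∧ ∀ (v : IsDedekindDomain.HeightOneSpectrum (NumberField.RingOfIntegers ℚ)), ((3 : ℕ) : NumberField.RingOfIntegers ℚ) ∈ v.asIdeal → ∀ 𝔓 ∈ v.primesAbove, ¬ (∀ g ∈ 𝔓.decompositionSubgroup (Field.absoluteGaloisGroup ℚ), ∀ P ∈ Φ, g • P = P) ∧ ¬ (∀ g ∈ 𝔓.decompositionSubgroup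 (Field.absoluteGaloisGroup ℚ), ∀ P : WeierstrassCurve.geomTorsion W ((3 : ℕ) : ℤ), g • P - P ∈ Φ)) → W.analyticRank = 1 → W.conductorNorm ℤ = N → Literature.NumberTheory.EllipticCurves.IsImaginaryQuadratic K → Literature.NumberTheory.EllipticCurves.SatisfiesHeegnerHypothesis N K → Odd (NumberField.discr K) → ∀ (κ : Literature.NumberTheory.EllipticCurves.ZpExtension K 3), κ.IsAnticyclotomic → ∀ (γ : Field.absoluteGaloisGroup K) [Fact (κ.IsTopGenerator γ)] (𝔭 : IsDedekindDomain.HeightOneSpectrum (NumberField.RingOfIntegers K)), ((3 : ℕ) : NumberField.RingOfIntegers K) ∈ 𝔭.asIdeal → 𝔭.asIdeal.ramificationIdx (NumberField.RingOfIntegers ℚ) = 1 → 𝔭.asIdeal.inertiaDeg (NumberField.RingOfIntegers ℚ) = 1 → ∀ (𝔭' : IsDedekindDomain.HeightOneSpectrum (NumberField.RingOfIntegers K)), ((3 : ℕ) : NumberField.RingOfIntegers K) ∈ 𝔭'.asIdeal → 𝔭' ≠ 𝔭 → ∀ (ι' : PadicAlgCl 3 ≃+* ℂ), Summit.BirchSwinnertonDyer.BirchSwinnertonDyer.Theorems.SchneiderFree.BranchInducesPrime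 3 ι' 𝔭 → ∀ (ΩK : ℂ) (Ωp : ℂ_[3]) (L : Literature.NumberTheory.EllipticCurves.UnrSeries 3), ΩK ≠ 0 → Ωp ≠ 0 → Literature.NumberTheory.EllipticCurves.IsBDPLFunction ι' 𝔭 κ γ Dt.f ΩK Ωp L → ∃ (g : Literature.NumberTheory.EllipticCurves.UnrSeries 3) (n : ℕ), (Summit.BirchSwinnertonDyer.Rank1Residual.X11b.AcSelmer.XAc.charIdeal (W.baseChange K) 3 κ 𝔭' ∅ γ).map (PowerSeries.map (Summit.BirchSwinnertonDyer.Rank1Residual.X11b.Halves.toUnr 3)) = Ideal.span {g} ∧ (∀ i < n, ‖((PowerSeries.coeff i g : Literature.NumberTheory.EllipticCurves.unrIntegers 3) : ℂ_[3])‖ < 1) ∧ ‖((PowerSeries.coeff n g : Literature.NumberTheory.EllipticCurves.unrIntegers 3) : ℂ_[3])‖ = 1 ∧ (∀ i < n, ‖((PowerSeries.coeff i L : Literature.NumberTheory.EllipticCurves.unrIntegers 3) : ℂ_[3])‖ < 1) ∧ ‖((PowerSeries.coeff n L : Literature.NumberTheory.EllipticCurves.unrIntegers 3) : ℂ_[3])‖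 = 1)
    (hW : Theses.UniversalToricDescent.WildSplitPrintedInputsAtThree)
    (hS : Theses.UniversalToricDescent.WildSplitFrameAtThreeOddOfPrint)
    (h4 : RedSplitControlAtThree) (h5 : WildRankZeroTwistAtThree)
    (W : WeierstrassCurve ℚ) [W.IsElliptic] [W.IsGloballyMinimal] (hCM : ¬ W.HasCM) (hO6 : ClassO6 W 3)
    (hr : W.analyticRank = 1) (hRed : Red W 3)
    (hcell : ∃ Φ : AddSubgroup (WeierstrassCurve.geomTorsion W ((3 : ℕ) : ℤ)), IsRationalLine W 3 Φ ∧
      ∀ (v : IsDedekindDomain.HeightOneSpectrum (NumberField.RingOfIntegers ℚ)),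
        ((3 : ℕ) : NumberField.RingOfIntegers ℚ) ∈ v.asIdeal → ∀ 𝔓 ∈ v.primesAbove,
          ¬ (∀ g ∈ 𝔓.decompositionSubgroup (Field.absoluteGaloisGroup ℚ), ∀ P ∈ Φ, g • P = P) ∧
          ¬ (∀ g ∈ 𝔓.decompositionSubgroup (Field.absoluteGaloisGroup ℚ),
              ∀ P : WeierstrassCurve.geomTorsion W ((3 : ℕ) : ℤ), g • P - P ∈ Φ)) :
    BSDp W 3 := by
  -- VERBATIM Theorems/CumulativeHeegnerLeopoldtLeopoldtKernelAtThreeOfPrint.lean (utd-p3 g8 / chl-p1 g0) with ONE token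
  -- changed: K2 is applied as `h2 … hHN hodd κ …` (the kernel had already derived `hodd` from Friedberg–Hoffstein at 2)
  obtain ⟨hGZ, hKo, hGZK, hmod, hmodP, -, hGZ73, hFH, hpar, hHP⟩ := hF
  haveI hN0 : NeZero (W.conductorNorm ℤ) := ⟨W.conductorNorm_pos_holds.ne'⟩
  -- (a) DATA. parity: `r_an = 1` is odd, so `w(E) = -1`
  have hw : W.rootNumber = -1 := by
    rcases W.rootNumber_eq_one_or with h | h
    · exfalso
      have heven : Even W.analyticRank := (hpar W).mpr h
      rw [hr] at heven
      exact Nat.not_even_one heven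
    · exact h
  -- Friedberg–Hoffstein with auxiliary modulus `2`: Heegner for `N(E)` and `2` split, so `d_K` is odd
  obtain ⟨K, _, _, hK, -, hHN, hH2, hLt⟩ := hFH W hw 2 two_ne_zero 0
  have hodd : Odd (NumberField.discr K) := by
    have h8 := Literature.SatisfiesHeegnerHypothesis.discr_emod_eight hK.1 hH2 (dvd_refl 2)
    rw [Int.odd_iff]; omega
  -- `3 ∣ N(E)` (additive) splits in `K`
  have h3N : 3 ∣ W.conductorNorm ℤ :=
    (W.dvd_conductorNorm_iff_not_hasGoodReductionAtPrime 3).mpr (not_good_of_addv W 3 hO6.2.1)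
  have hsplit : SplitsIn K 3 := hHN 3 Nat.prime_three h3N
  -- the Heegner point over `K` and its data; non-torsion by Gross–Zagier
  obtain ⟨P, Dt, H, ι, hP⟩ := hHP W K hK hHN
  have hL0 : W.entireLFunction 1 = 0 := entireLFunction_one_eq_zero_of_analyticRank_eq_one hr
  obtain ⟨-, hderiv⟩ := leadingLCoeff_eq_deriv_of_analyticRank_eq_one hr
  have hLK : LDerivEK W K ≠ 0 := by
    rw [lDerivEK_eq_deriv_mul W K hmod hL0]; exact mul_ne_zero hderiv hLt
  have hnt : ¬ IsOfFinAddOrder P :=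
    (lDerivEK_ne_zero_iff_not_isOfFinAddOrder W (W.conductorNorm ℤ) K (hGZ _ W K) hK hHN
      ⟨Dt, H, ι, hP⟩).mp hLK
  -- Kolyvagin: `rank E(K) = 1`, `Ш(E/K)` finite
  obtain ⟨hrk, hfin⟩ := hKo (W.conductorNorm ℤ) W K hK hHN ⟨Dt, H, ι, hP⟩ hnt
  -- a frame `(κ, γ, 𝔭)` and the other prime `𝔭′ ≠ 𝔭` above `3`
  obtain ⟨κ, γ, -, hκ, hγ, -⟩ := X11b.exists_anticyclotomic_generator_prime (p := 3) hK
  haveI : Fact (κ.IsTopGenerator γ) := ⟨hγ⟩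
  obtain ⟨𝔭, h𝔭, he, hf⟩ := X11b.exists_degreeOnePrime_of_splitsIn K 3 hK.1 hsplit
  obtain ⟨𝔭', hne, h𝔭', he', hf'⟩ := X11b.Three.exists_ne_degreeOne_prime hK.1 h𝔭 he hf
  -- (b) PLUMBING. K3: an `R₀`-frame `L` at `(κ, γ, 𝔭)`; its unit value by LZZ
  obtain ⟨ι', hind, ΩK, Ωp, L, hΩK, hΩp, hBDP⟩ :=
    hS hW.1 hW.2.1 W (W.conductorNorm ℤ) K Dt hO6 rfl hK hHN hodd κ hκ γ 𝔭 h𝔭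
  -- the unit value `L(𝟙) = u·(log_𝔭 P / c)²`, `u ∈ R₀ˣ` (♭-rigidity + LZZ; the scalar `[T⁰]L / x²` lies in
  -- `Frac R₀` with norm one, hence in `R₀ˣ`) — the body of UTD's `wildSplitWaldspurgerAtThree_of_lzz_of_frame`
  obtain ⟨u, hval⟩ : ∃ u : (unrIntegers 3)ˣ, L.HasValueAt 0 ((((u : unrIntegers 3) : unrIntegers 3) : ℂ_[3]) *
      (algebraMap ℚ_[3] ℂ_[3] (logOmega W 3 (embAt K 3 𝔭 h𝔭 he hf) P / (Dt.c : ℚ_[3]))) ^ 2) := by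
    have hQ' : R1.IsBDPLFunctionInt 3 ι' 𝔭 κ γ Dt.f ΩK Ωp (PowerSeries.map (R1.unrToCpInt 3) L) :=
      R1.isBDPLFunctionInt_map hBDP
    obtain ⟨u₀, hu₀, hv⟩ := UniversalToricDescentWaldspurgerFlat.wildSplitWaldspurgerAtThree_flat_forall hL W
      (W.conductorNorm ℤ) K Dt H ι P hO6 rfl hK hHN hP hnt κ hκ γ 𝔭 h𝔭 he hf ι' hind hΩK hΩp hQ'
    set x : ℚ_[3] := logOmega W 3 (embAt K 3 𝔭 h𝔭 he hf) P / (Dt.c : ℚ_[3]) with hx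
    have hv' : L.HasValueAt 0 (u₀ * (algebraMap ℚ_[3] ℂ_[3] x) ^ 2) :=
      (R1.intSeries_hasValueAt_map_iff 3 L _ _).mp hv
    have hcoef : ((PowerSeries.constantCoeff L : unrIntegers 3) : ℂ_[3]) =
        u₀ * (algebraMap ℚ_[3] ℂ_[3] x) ^ 2 :=
      (UnrSeries.eq_constantCoeff_of_hasValueAt_zero hv').symm
    have hlogne : logOmega W 3 (embAt K 3 𝔭 h𝔭 he hf) P ≠ 0 := R1.logOmega_ne_zero W 3 _ hnt
    have hcZ : Dt.c ≠ 0 := Dt.maninConstant_ne_zero_holds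
    have hx0 : x ≠ 0 := div_ne_zero hlogne (by exact_mod_cast hcZ)
    have hx2 : x ^ 2 ≠ 0 := pow_ne_zero _ hx0
    set y : ℂ_[3] := algebraMap ℚ_[3] ℂ_[3] (x ^ 2) with hy
    have hy0 : y ≠ 0 := (map_ne_zero_iff _ (algebraMap ℚ_[3] ℂ_[3]).injective).mpr hx2
    have hnorm : ‖((PowerSeries.constantCoeff L : unrIntegers 3) : ℂ_[3])‖ = ‖y‖ := by
      rw [hcoef, norm_mul, hu₀, one_mul, hy, map_pow]
    have hyF : y ∈ Subfield.closure (unrIntegers 3 : Set ℂ_[3]) := by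
      rw [hy, IsScalarTower.algebraMap_apply ℚ_[3] (PadicAlgCl 3) ℂ_[3] (x ^ 2)]
      exact PadicComplexTransport.algebraMap_padic_mem_fracUnr 3 (x ^ 2)
    set c₀ : ℂ_[3] := ((PowerSeries.constantCoeff L : unrIntegers 3) : ℂ_[3]) with hc₀
    have hw : c₀ / y ∈ Subfield.closure (unrIntegers 3 : Set ℂ_[3]) :=
      div_mem (Subfield.subset_closure (PowerSeries.constantCoeff L).2) hyF
    have hw1 : ‖c₀ / y‖ = 1 := by
      rw [norm_div, hc₀, hnorm, div_self (norm_ne_zero_iff.mpr hy0)]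
    have hwR : c₀ / y ∈ unrIntegers 3 := R1.mem_unrIntegers_of_mem_fracUnr hw hw1.le
    obtain ⟨u, hu⟩ := (unrIntegers.isUnit_iff_norm_eq_one ⟨c₀ / y, hwR⟩).mpr hw1
    refine ⟨u, ?_⟩
    have hval : ((u : unrIntegers 3) : ℂ_[3]) * (algebraMap ℚ_[3] ℂ_[3] x) ^ 2 = c₀ := by
      rw [hu, ← map_pow, ← hy]
      exact div_mul_cancel₀ c₀ hy0
    have h0 := L.hasValueAt_zero
    rw [← hc₀, ← hval] at h0
    exact h0
  -- K1: the inclusion `(L) ⊆ Ch·R₀⟦T⟧` at `𝔭′`; K2: the norm profile; hence the IMC EQUALITY at the frame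
  have hincl : Ideal.span {L} ≤
      (XAc.charIdeal (W.baseChange K) 3 κ 𝔭' ∅ γ).map (PowerSeries.map (toUnr 3)) :=
    h1 W (W.conductorNorm ℤ) K Dt hO6 hRed hcell hr rfl hK hHN κ hκ γ 𝔭 h𝔭 he hf 𝔭' h𝔭' hne ι' hind ΩK Ωp L
      hΩK hΩp hBDP
  obtain ⟨g, n₀, hg, hglt, -, -, hLn⟩ := h2 W (W.conductorNorm ℤ) K Dt hO6 hRed hcell hr rfl hK hHN hodd κ hκ γ 𝔭
    h𝔭 he hf 𝔭' h𝔭' hne ι' hind ΩK Ωp L hΩK hΩp hBDP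
  have heq : (XAc.charIdeal (W.baseChange K) 3 κ 𝔭' ∅ γ).map (PowerSeries.map (toUnr 3)) =
      Ideal.span {L} :=
    UniversalToricDescentNormProfile.eq_span_of_span_le_of_normProfile hg hincl hglt hLn
  -- K4: control EQUALITY at `𝔭′` (CTL₀ included)
  have hctl : SchneiderFree.AdditiveControlOnTreeAt 3 κ 𝔭' γ (embAt K 3 𝔭' h𝔭' he' hf') P :=
    h4 W (W.conductorNorm ℤ) K Dt H ι P hO6 hRed hcell hr rfl hK hHN hLt hP hnt (hKo _ W K) κ hκ γ 𝔭'
      h𝔭' he' hf'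
  obtain ⟨n, hn, hneq⟩ := hctl
  -- the value read through the logarithm at `𝔭′` (rank one: `(log_{𝔭′} P)² = (log_𝔭 P)²`)
  have hval' : L.HasValueAt 0 ((((u : unrIntegers 3) : unrIntegers 3) : ℂ_[3]) *
      (algebraMap ℚ_[3] ℂ_[3]
        (logOmega W 3 (embAt K 3 𝔭' h𝔭' he' hf') P / (Dt.c : ℚ_[3]))) ^ 2) :=
    (SchneiderFreeAdditiveX3.hasValueAt_sq_logOmega_embAt_iff_of_rank_one W 3 hK.1 hrk h𝔭 he hf
      h𝔭' he' hf' P _ _ L).mpr hval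
  -- both sockets at slack `v₃(c)` at the frame `(κ, 𝔭′, γ, embAt 𝔭′)`
  have hc0 : Dt.c ≠ 0 := Dt.maninConstant_ne_zero_holds
  have hlog : logOmega W 3 (embAt K 3 𝔭' h𝔭' he' hf') P ≠ 0 := X11b.R1.logOmega_ne_zero W 3 _ hnt
  have hlow : SchneiderFree.AdditiveIMCLowerBDPOnTreeLeAt 3 κ 𝔭' γ (embAt K 3 𝔭' h𝔭' he' hf')
      (padicValNat 3 Dt.c.natAbs) P := by
    -- the LOWER norm receptacle (`⊆` + value): `2·ord₃(log_{𝔭′}P / c) ≤ ord₃ f(0)`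
    obtain ⟨htors, f, hfI, hf0, hfn⟩ := hn
    have hmem : PowerSeries.map (toUnr 3) f ∈ Ideal.span {L} := by
      have h3 := heq.le
      rw [hfI, CongruenceLimit.map_span_singleton_powerSeries] at h3
      exact (Ideal.span_singleton_le_iff_mem _).mp h3
    obtain ⟨-, hle⟩ := Supersingular.two_mul_valuation_le_of_mem_span 3 hf0 hmem u hval'
    have hc0' : (Dt.c : ℚ_[3]) ≠ 0 := by exact_mod_cast hc0
    rw [div_eq_mul_inv, Padic.valuation_mul hlog (inv_ne_zero hc0'), Padic.valuation_inv,
      Padic.valuation_intCast, valuation_logOmega hlog, hfn] at hle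
    refine ⟨n, ⟨htors, f, hfI, hf0, hfn⟩, ?_⟩
    simp only [padicValInt] at hle
    linarith
  have hup : SchneiderFree.Upper.AdditiveIMCUpperBDPOnTreeLeAt 3 κ 𝔭' γ (embAt K 3 𝔭' h𝔭' he' hf')
      (padicValNat 3 Dt.c.natAbs) P :=
    SchneiderFree.Upper.additiveIMCUpperBDPOnTreeLeAt_of_value_of_dvd' hn heq.ge u hc0 hlog hval'
  -- the EXACT index at slack `v₃(c)` (both halves), by K1's links with the control equality
  have hlo : SchneiderFree.IndexLowerBoundLeAt W 3 K P (padicValNat 3 Dt.c.natAbs) :=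
    SchneiderFreeAdditiveX3.indexLowerBoundLeAt_of_imcLowerLe_of_control rfl hK hHN hfin hlow
      ⟨n, hn, hneq⟩
  have hupI : SchneiderFree.Upper.IndexUpperBoundLeAt W 3 K P (padicValNat 3 Dt.c.natAbs) :=
    SchneiderFree.Upper.indexUpperBoundLeAt_of_imcUpperLe_of_control rfl hK hHN hfin hup ⟨n, hn, hneq⟩
  -- (c) TERMINAL STEP: a globally minimal model of the twist — a NON-CM O6 row of analytic rank `0`
  have hD0 : (NumberField.discr K : ℚ) ≠ 0 := by exact_mod_cast NumberField.discr_ne_zero K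
  haveI : (W.quadraticTwist (NumberField.discr K : ℚ)).IsElliptic := W.isElliptic_quadraticTwist hD0
  obtain ⟨Cd, hCd⟩ := hasGlobalMinimalModel_rat_holds (W.quadraticTwist (NumberField.discr K : ℚ))
  haveI : (Cd • W.quadraticTwist (NumberField.discr K : ℚ)).IsGloballyMinimal := hCd
  set Wd : WeierstrassCurve ℚ := Cd • W.quadraticTwist (NumberField.discr K : ℚ) with hWd
  have hw3 : ¬ 3 ∣ Units.torsionOrder K :=
    (X11b.Three.not_dvd_discr_and_not_dvd_torsionOrder_of_heegner hK hHN (by decide) h3N).2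
  obtain ⟨hO6d, hjd⟩ := classO6_twist_of_heegner W hO6 K hK hHN hodd Wd Cd rfl
  have hCMd : ¬ Wd.HasCM := fun h ↦ hCM ((hasCM_iff_of_j_eq hjd).mp h)
  have hLd1 : Wd.entireLFunction 1 ≠ 0 := by rw [hWd, entireLFunction_smul]; exact hLt
  have hrd : Wd.analyticRank = 0 := analyticRank_eq_zero_of_entireLFunction_one_ne_zero Wd hLd1
  have hBSDd : BSDp Wd 3 := h5 Wd hCMd hO6d hrd
  exact SchneiderFree.Exact.bsdp_of_exactIndexManin_of_partner_bsdp hGZ hKo hGZK hmod hGZ73 W 3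
    (W.conductorNorm ℤ) K Dt H ι P Wd hr rfl h3N hK hodd hw3 hHN hLt hP ⟨Cd, rfl⟩ (by decide) hlo hupI hBSDd

/-! ## §2 The W-ALL leaf from the residual content after the character cut -/

/-- **The W-ALL leaf `WAllExclAddWildRankOne` (BSD₃ for every non-CM wild-additive-at-3 curve of analytic rank one)
from the route's residual content AFTER the character cut of K2, composed BY NAME.** Hypotheses (all displayed,
nothing asserted): the three print packages `hF hL hW`; `hS` = UTD's `WildSplitFrameAtThreeOddOfPrint` (24475 — a TREE
THEOREM, `wildSplitFrameAtThreeOddOfPrint_proof` p596578, displayed here only to keep this file outside UTD's rebuild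
cone); crux A `TemperedHeegnerInclusionAtThree` (26896); the print
fact `hP` = CGLS22 Prop. 14 (item 26897); the K2-line stubs `halg` [ALG], `han` [AN], `hram` [BRram] (binder types of
p614352 VERBATIM), `hbr` = `CharMainConjOnTree 3`, `hKatz` = `thm212_exists_isKatzLFunction` (print); K5 `h5`; K6 `h6`.
Proof: K1 ⟸ A ∧ B1 (p611195 §1) with B1 ⟸ hP (p616187 parts); K2_odd ⟸ hP ∧ [LOC₃] (p682321) ∧ halg ∧ han ∧ hram ∧
hbr ∧ hKatz 3 (p681722); K4 is the tree theorem `redSplitControlAtThree_proof`; on the cell §1, off the cell K6.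
[cite: CastellaGrossiLeeSkinner2022, Prop. 14, Thm. 1.5.1, Thm. 2.2.4, Thm. 3.2.1] [cite: JetchevSkinnerWan2017, §7.4.1] -/
theorem wAllExclAddWildRankOne_of_characterCut
    (hF : ToricPublishedInputs) (hL : LiuZhangZhangAdditiveInput) (hW : WildSplitPrintedInputsAtThree)
    (hS : Theses.UniversalToricDescent.WildSplitFrameAtThreeOddOfPrint)
    (hA : TemperedHeegnerInclusionAtThree)
    (hP : Literature.NumberTheory.EllipticCurves.CastellaGrossiLeeSkinner2022.prop14_residualCharacterSelmer_finite)
    (halg : ∀ (W : WeierstrassCurve ℚ) [W.IsElliptic] [W.IsGloballyMinimal] (N : ℕ) [NeZero N] (K : Type) [Field K] [NumberField K], Summit.BirchSwinnertonDyer.Rank1Residual.Additive.ClassO6 W 3 → Literature.NumberTheory.EllipticCurves.Rank1Residual.Red W 3 → (∃ Φ : AddSubgroup (WeierstrassCurve.geomTorsion W ((3 : ℕ) : ℤ)), Literature.NumberTheory.EllipticCurves.Rank1Residual.IsRationalLine W 3 Φ ∧ ∀ (v : IsDedekindDomain.HeightOneSpectrum (NumberField.RingOfIntegers ℚ)), ((3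 : ℕ) : NumberField.RingOfIntegers ℚ) ∈ v.asIdeal → ∀ 𝔓 ∈ v.primesAbove, ¬ (∀ g ∈ 𝔓.decompositionSubgroup (Field.absoluteGaloisGroup ℚ), ∀ P ∈ Φ, g • P = P) ∧ ¬ (∀ g ∈ 𝔓.decompositionSubgroup (Field.absoluteGaloisGroup ℚ), ∀ P : WeierstrassCurve.geomTorsion W ((3 : ℕ) : ℤ), g • P - P ∈ Φ)) → W.conductorNorm ℤ = N → Literature.NumberTheory.EllipticCurves.IsImaginaryQuadratic K → Literature.NumberTheory.EllipticCurves.SatisfiesHeegnerHypothesis N K → Odd (NumberField.discr K) → (∀ Q : (W.baseChange K).toAffine.Point, (3 : ℕ) • Q = 0 → Q = 0) → ∀ (κ : Literature.NumberTheory.EllipticCurves.ZpExtension K 3), κ.IsAnticyclotomic → ∀ (γ : Field.absoluteGaloisGroup K) [Fact (κ.IsTopGenerator γ)] (𝔭 : IsDedekindDomain.HeightOneSpectrum (NumberField.RingOfIntegers K)), ((3 : ℕ) : NumberField.RingOfIntegers K) ∈ 𝔭.asIdeal → 𝔭.asIdeal.ramificationIdx (NumberField.RingOfIntegers ℚ)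 = 1 → 𝔭.asIdeal.inertiaDeg (NumberField.RingOfIntegers ℚ) = 1 → ∀ (𝔭' : IsDedekindDomain.HeightOneSpectrum (NumberField.RingOfIntegers K)), ((3 : ℕ) : NumberField.RingOfIntegers K) ∈ 𝔭'.asIdeal → 𝔭' ≠ 𝔭 → ∀ (θsub θquot : FramedGaloisRep K (padicCoeffIntegers (∅ : Set (PadicAlgCl 3))) 1), Literature.NumberTheory.EllipticCurves.KellerYin2024.IsResidualPairOver (W.baseChange K) 3 θsub θquot → ∀ (Sf : Finset (IsDedekindDomain.HeightOneSpectrum (NumberField.RingOfIntegers K))), (∀ w : IsDedekindDomain.HeightOneSpectrum (NumberField.RingOfIntegers K), w ∈ Sf ↔ ((W.conductorNorm ℤ : ℤ) : NumberField.RingOfIntegers K) ∈ w.asIdeal) → ∀ (Dsub : Literature.NumberTheory.EllipticCurves.GreenbergVatsal2000.DatumDualData κ γ (Literature.NumberTheory.EllipticCurves.KellerYin2024.charModule (∅ : Set (PadicAlgCl 3)) θsub) (Literature.NumberTheory.EllipticCurves.Castella2018.AcSelmer.bdpData (Literature.NumberTheory.EllipticCurves.KellerYin2024.charModule (∅ :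 Set (PadicAlgCl 3)) θsub) 3 𝔭') ∅) (Dquot : Literature.NumberTheory.EllipticCurves.GreenbergVatsal2000.DatumDualData κ γ (Literature.NumberTheory.EllipticCurves.KellerYin2024.charModule (∅ : Set (PadicAlgCl 3)) θquot) (Literature.NumberTheory.EllipticCurves.Castella2018.AcSelmer.bdpData (Literature.NumberTheory.EllipticCurves.KellerYin2024.charModule (∅ : Set (PadicAlgCl 3)) θquot) 3 𝔭') ∅), Module.Finite (Literature.NumberTheory.EllipticCurves.IwasawaAlgebra 3) (Summit.BirchSwinnertonDyer.Rank1Residual.X11b.AcSelmer.XAc (W.baseChange K) 3 κ 𝔭' ∅ γ) ∧ Module.IsTorsion (Literature.NumberTheory.EllipticCurves.IwasawaAlgebra 3) (Summit.BirchSwinnertonDyer.Rank1Residual.X11b.AcSelmer.XAc (W.baseChange K) 3 κ 𝔭' ∅ γ) ∧ Literature.NumberTheory.EllipticCurves.muInvariant 3 (Summit.BirchSwinnertonDyer.Rank1Residual.X11b.AcSelmer.XAc (W.baseChange K) 3 κ 𝔭' ∅ γ) = 0 ∧ Literature.NumberTheory.EllipticCurves.lambdaInvariant 3 (Summit.BirchSwinnertonDyer.Rank1Residual.X11b.AcSelmer.XAc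 (W.baseChange K) 3 κ 𝔭' ∅ γ) + ∑ w ∈ Sf, Literature.NumberTheory.EllipticCurves.KellerYin2024.curveLocalLambda κ (W.baseChange K) w = Literature.NumberTheory.EllipticCurves.lambdaInvariant 3 Dsub.X + Literature.NumberTheory.EllipticCurves.lambdaInvariant 3 Dquot.X + ∑ w ∈ Sf, (Literature.NumberTheory.EllipticCurves.KellerYin2024.charLocalLambda (∅ : Set (PadicAlgCl 3)) κ θsub w + Literature.NumberTheory.EllipticCurves.KellerYin2024.charLocalLambda (∅ : Set (PadicAlgCl 3)) κ θquot w))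
    (han : ∀ (W : WeierstrassCurve ℚ) [W.IsElliptic] [W.IsGloballyMinimal] (N : ℕ) [NeZero N] (K : Type) [Field K] [NumberField K] (Dt : Literature.NumberTheory.EllipticCurves.ModularForms.ModularParametrizationData W N), Summit.BirchSwinnertonDyer.Rank1Residual.Additive.ClassO6 W 3 → Literature.NumberTheory.EllipticCurves.Rank1Residual.Red W 3 → (∃ Φ : AddSubgroup (WeierstrassCurve.geomTorsion W ((3 : ℕ) : ℤ)), Literature.NumberTheory.EllipticCurves.Rank1Residual.IsRationalLine W 3 Φ ∧ ∀ (v : IsDedekindDomain.HeightOneSpectrum (NumberField.RingOfIntegers ℚ)), ((3 : ℕ) : NumberField.RingOfIntegers ℚ) ∈ v.asIdeal → ∀ 𝔓 ∈ v.primesAbove, ¬ (∀ g ∈ 𝔓.decompositionSubgroup (Field.absoluteGaloisGroup ℚ), ∀ P ∈ Φ, g • P = P) ∧ ¬ (∀ g ∈ 𝔓.decompositionSubgroup (Field.absoluteGaloisGroup ℚ), ∀ P : WeierstrassCurve.geomTorsion W ((3 : ℕ) : ℤ), g • P - P ∈ Φ)) → W.analyticRank = 1 → W.conductorNorm ℤ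 = N → Literature.NumberTheory.EllipticCurves.IsImaginaryQuadratic K → Literature.NumberTheory.EllipticCurves.SatisfiesHeegnerHypothesis N K → Odd (NumberField.discr K) → ∀ (κ : Literature.NumberTheory.EllipticCurves.ZpExtension K 3), κ.IsAnticyclotomic → ∀ (γ : Field.absoluteGaloisGroup K) [Fact (κ.IsTopGenerator γ)] (𝔭 : IsDedekindDomain.HeightOneSpectrum (NumberField.RingOfIntegers K)), ((3 : ℕ) : NumberField.RingOfIntegers K) ∈ 𝔭.asIdeal → 𝔭.asIdeal.ramificationIdx (NumberField.RingOfIntegers ℚ) = 1 → 𝔭.asIdeal.inertiaDeg (NumberField.RingOfIntegers ℚ) = 1 → ∀ (𝔭' : IsDedekindDomain.HeightOneSpectrum (NumberField.RingOfIntegers K)), ((3 : ℕ) : NumberField.RingOfIntegers K) ∈ 𝔭'.asIdeal → 𝔭' ≠ 𝔭 → ∀ (ι' : PadicAlgCl 3 ≃+* ℂ), Summit.BirchSwinnertonDyer.BirchSwinnertonDyer.Theorems.SchneiderFree.BranchInducesPrime 3 ι' 𝔭 → ∀ (ΩK : ℂ) (Ωp : ℂ_[3]) (L : Literature.NumberTheory.EllipticCurves.UnrSeries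 3), ΩK ≠ 0 → Ωp ≠ 0 → Literature.NumberTheory.EllipticCurves.IsBDPLFunction ι' 𝔭 κ γ Dt.f ΩK Ωp L → ∀ (θsub θquot : FramedGaloisRep ℚ (padicCoeffIntegers (∅ : Set (PadicAlgCl 3))) 1), Literature.NumberTheory.EllipticCurves.KellerYin2024.IsResidualPairOver (W.baseChange K) 3 (θsub.restrictField K) (θquot.restrictField K) → ∀ (θunr : FramedGaloisRep ℚ (padicCoeffIntegers (∅ : Set (PadicAlgCl 3))) 1), (θunr = θsub ∨ θunr = θquot) → (∀ u : IsDedekindDomain.HeightOneSpectrum (NumberField.RingOfIntegers ℚ), ((3 : ℕ) : NumberField.RingOfIntegers ℚ) ∈ u.asIdeal → θunr.IsUnramifiedAt u) → ∀ (Sf : Finset (IsDedekindDomain.HeightOneSpectrum (NumberField.RingOfIntegers K))), (∀ w : IsDedekindDomain.HeightOneSpectrum (NumberField.RingOfIntegers K), w ∈ Sf ↔ ((W.conductorNorm ℤ : ℤ) : NumberField.RingOfIntegers K) ∈ w.asIdeal) → ∀ (θK : HeckeCharacter K), Literature.NumberTheory.EllipticCurves.KellerYin2024.IsHeckeCharOf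 ι' (θunr.restrictField K) θK → ∀ (Cbar : Finset (IsDedekindDomain.HeightOneSpectrum (NumberField.RingOfIntegers K))), (∀ u ∈ Cbar, ¬ θK.IsUnramifiedAt u) → ∀ (ΩK' : ℂ) (Ωp' : (Literature.NumberTheory.EllipticCurves.unrIntegers 3)ˣ) (Lφ : Literature.NumberTheory.EllipticCurves.UnrSeries 3), ΩK' ≠ 0 → Literature.NumberTheory.EllipticCurves.CastellaGrossiLeeSkinner2022.IsKatzLFunction ι' 𝔭 𝔭' Cbar κ γ θK ΩK' ((Ωp' : Literature.NumberTheory.EllipticCurves.unrIntegers 3) : ℂ_[3]) Lφ → ∃ n nφ : ℕ, Literature.NumberTheory.EllipticCurves.KellerYin2024.FirstUnitCoeffAt L n ∧ Literature.NumberTheory.EllipticCurves.KellerYin2024.FirstUnitCoeffAt Lφ nφ ∧ n + ∑ w ∈ Sf, Literature.NumberTheory.EllipticCurves.KellerYin2024.curveLocalLambda κ (W.baseChange K) w = 2 * nφ + ∑ w ∈ Sf, (Literature.NumberTheory.EllipticCurves.KellerYin2024.charLocalLambda (∅ : Set (PadicAlgCl 3)) κ (θsub.restrictField K) w + Literature.NumberTheory.EllipticCurves.KellerYin2024.charLocalLambda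 (∅ : Set (PadicAlgCl 3)) κ (θquot.restrictField K) w))
    (hram : ∀ (W : WeierstrassCurve ℚ) [W.IsElliptic] [W.IsGloballyMinimal] (N : ℕ) [NeZero N] (K : Type) [Field K] [NumberField K], Summit.BirchSwinnertonDyer.Rank1Residual.Additive.ClassO6 W 3 → Literature.NumberTheory.EllipticCurves.Rank1Residual.Red W 3 → (∃ Φ : AddSubgroup (WeierstrassCurve.geomTorsion W ((3 : ℕ) : ℤ)), Literature.NumberTheory.EllipticCurves.Rank1Residual.IsRationalLine W 3 Φ ∧ ∀ (v : IsDedekindDomain.HeightOneSpectrum (NumberField.RingOfIntegers ℚ)), ((3 : ℕ) : NumberField.RingOfIntegers ℚ) ∈ v.asIdeal → ∀ 𝔓 ∈ v.primesAbove, ¬ (∀ g ∈ 𝔓.decompositionSubgroup (Field.absoluteGaloisGroup ℚ), ∀ P ∈ Φ, g • P = P) ∧ ¬ (∀ g ∈ 𝔓.decompositionSubgroup (Field.absoluteGaloisGroup ℚ), ∀ P : WeierstrassCurve.geomTorsion W ((3 : ℕ) : ℤ), g • P - P ∈ Φ)) → W.conductorNorm ℤ = N → Literature.NumberTheory.EllipticCurves.IsImaginaryQuadratic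 K → Literature.NumberTheory.EllipticCurves.SatisfiesHeegnerHypothesis N K → Odd (NumberField.discr K) → (∀ Q : (W.baseChange K).toAffine.Point, (3 : ℕ) • Q = 0 → Q = 0) → ∀ (κ : Literature.NumberTheory.EllipticCurves.ZpExtension K 3), κ.IsAnticyclotomic → ∀ (γ : Field.absoluteGaloisGroup K) [Fact (κ.IsTopGenerator γ)] (𝔭 : IsDedekindDomain.HeightOneSpectrum (NumberField.RingOfIntegers K)), ((3 : ℕ) : NumberField.RingOfIntegers K) ∈ 𝔭.asIdeal → 𝔭.asIdeal.ramificationIdx (NumberField.RingOfIntegers ℚ) = 1 → 𝔭.asIdeal.inertiaDeg (NumberField.RingOfIntegers ℚ) = 1 → ∀ (𝔭' : IsDedekindDomain.HeightOneSpectrum (NumberField.RingOfIntegers K)), ((3 : ℕ) : NumberField.RingOfIntegers K) ∈ 𝔭'.asIdeal → 𝔭' ≠ 𝔭 → ∀ (ι' : PadicAlgCl 3 ≃+* ℂ), Summit.BirchSwinnertonDyer.BirchSwinnertonDyer.Theorems.SchneiderFree.BranchInducesPrime 3 ι' 𝔭 → ∀ (Φ : AddSubgroup (WeierstrassCurve.geomTorsion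 W ((3 : ℕ) : ℤ))), Literature.NumberTheory.EllipticCurves.Rank1Residual.IsRationalLine W 3 Φ → ∀ (θsub θquot : FramedGaloisRep ℚ (padicCoeffIntegers (∅ : Set (PadicAlgCl 3))) 1), Literature.NumberTheory.EllipticCurves.KellerYin2024.IsTeichmullerLiftOn (∅ : Set (PadicAlgCl 3)) (Φ.map (WeierstrassCurve.geomTorsion W ((3 : ℕ) : ℤ)).subtype) θsub → Literature.NumberTheory.EllipticCurves.KellerYin2024.IsTeichmullerLiftOnQuot (∅ : Set (PadicAlgCl 3)) (Φ.map (WeierstrassCurve.geomTorsion W ((3 : ℕ) : ℤ)).subtype) (WeierstrassCurve.geomTorsion W ((3 : ℕ) : ℤ)) θquot → ∀ (θunr θram : FramedGaloisRep ℚ (padicCoeffIntegers (∅ : Set (PadicAlgCl 3))) 1), ((θunr = θsub ∧ θram = θquot) ∨ (θunr = θquot ∧ θram = θsub)) → (∀ u : IsDedekindDomain.HeightOneSpectrum (NumberField.RingOfIntegers ℚ), ((3 : ℕ) : NumberField.RingOfIntegers ℚ) ∈ u.asIdeal → θunr.IsUnramifiedAt u) → ∀ (θK : HeckeCharacter K),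 Literature.NumberTheory.EllipticCurves.KellerYin2024.IsHeckeCharOf ι' (θunr.restrictField K) θK → ∀ (Cbar : Finset (IsDedekindDomain.HeightOneSpectrum (NumberField.RingOfIntegers K))), (∀ u ∈ Cbar, ¬ θK.IsUnramifiedAt u) → ∀ (ΩK' : ℂ) (Ωp' : (Literature.NumberTheory.EllipticCurves.unrIntegers 3)ˣ) (Lφ : Literature.NumberTheory.EllipticCurves.UnrSeries 3), ΩK' ≠ 0 → Literature.NumberTheory.EllipticCurves.CastellaGrossiLeeSkinner2022.IsKatzLFunction ι' 𝔭 𝔭' Cbar κ γ θK ΩK' ((Ωp' : Literature.NumberTheory.EllipticCurves.unrIntegers 3) : ℂ_[3]) Lφ → ∀ nφ : ℕ, Literature.NumberTheory.EllipticCurves.KellerYin2024.FirstUnitCoeffAt Lφ nφ → ∀ (Dram : Literature.NumberTheory.EllipticCurves.GreenbergVatsal2000.DatumDualData κ γ (Literature.NumberTheory.EllipticCurves.KellerYin2024.charModule (∅ : Set (PadicAlgCl 3)) (θram.restrictField K)) (Literature.NumberTheory.EllipticCurves.Castella2018.AcSelmer.bdpData (Literature.NumberTheory.EllipticCurves.KellerYin2024.charModule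 (∅ : Set (PadicAlgCl 3)) (θram.restrictField K)) 3 𝔭') ∅), Module.Finite (Literature.NumberTheory.EllipticCurves.IwasawaAlgebra 3) Dram.X ∧ Module.IsTorsion (Literature.NumberTheory.EllipticCurves.IwasawaAlgebra 3) Dram.X ∧ Literature.NumberTheory.EllipticCurves.muInvariant 3 Dram.X = 0 ∧ Literature.NumberTheory.EllipticCurves.lambdaInvariant 3 Dram.X = nφ)
    (hbr : X1.KellerYinMuLambdaSplit.CharMainConjOnTree 3)
    (hKatz : Literature.NumberTheory.EllipticCurves.CastellaGrossiLeeSkinner2022.thm212_exists_isKatzLFunction)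
    (h5 : WildRankZeroTwistAtThree) (h6 : WildRankOneOffLeopoldtCellAtThree) :
    Summit.BirchSwinnertonDyer.WAllExclAddWildRankOne := by
  -- K1 from A and B1 (B1 from the print fact): A gives `(3^μ L) ⊆ Ch·R₀⟦T⟧`, B1 gives `Ch·R₀⟦T⟧ = (g)` with a
  -- norm-one coefficient (p606940), stub C saturates (p595383) — the composition of K1's line birth (p611195 §1)
  have hB1 := CumulativeHeegnerInclusionAtThreeB1OfPrint.stub_residualSelmerFinite_of_print hP
    CumulativeHeegnerInclusionAtThreeLineDet.stub_lineDeterminantAtThree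
    CumulativeHeegnerInclusionAtThreeBadPlaces.stub_badPlacesSplitFinite
  have h1 : CumulativeHeegnerInclusionAtThree := by
    intro W _ _ N _ K _ _ Dt hO6 hRed hcell hr hN hK hHg κ hκ γ _ 𝔭 h𝔭 he hf 𝔭' h𝔭' hne ι' hι ΩK Ωp L hΩK hΩp hBDP
    obtain ⟨μ, hμ⟩ := hA W N K Dt hO6 hRed hcell hr hN hK hHg κ hκ γ 𝔭 h𝔭 he hf 𝔭' h𝔭' hne ι' hι ΩK Ωp L hΩK hΩp
      hBDP
    obtain ⟨g, n, hg, hunit⟩ :=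
      CumulativeHeegnerInclusionAtThreeMuHalf.stub_charPrincipalMuZero_of_stub_residualSelmerFinite hB1 W N K Dt hO6
        hRed hcell hr hN hK hHg κ hκ γ 𝔭 h𝔭 he hf 𝔭' h𝔭' hne ι' hι ΩK Ωp L hΩK hΩp hBDP
    rw [hg] at hμ ⊢
    exact CumulativeHeegnerInclusionAtThreeSaturation.stub_threeSaturation L g μ n hunit hμ
  -- K2 at odd `d_K` from the character cut
  have h2 := EisensteinCharacterInvariantsAtThreeCharacterCutEq.eisensteinCharacterInvariantsAtThree_odd_of_print_of_characterCut
    hP EisensteinCharacterInvariantsAtThreeLocThree.isUnramifiedAt_three_sub_or_quot halg han hram hbr (hKatz 3)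
  intro W _ _ hCM hO6 hr
  by_cases hcell : (Red W 3 ∧ (∃ Φ : AddSubgroup (WeierstrassCurve.geomTorsion W ((3 : ℕ) : ℤ)),
    IsRationalLine W 3 Φ ∧ ∀ (v : IsDedekindDomain.HeightOneSpectrum (NumberField.RingOfIntegers ℚ)),
      ((3 : ℕ) : NumberField.RingOfIntegers ℚ) ∈ v.asIdeal → ∀ 𝔓 ∈ v.primesAbove,
        ¬ (∀ g ∈ 𝔓.decompositionSubgroup (Field.absoluteGaloisGroup ℚ), ∀ P ∈ Φ, g • P = P) ∧
        ¬ (∀ g ∈ 𝔓.decompositionSubgroup (Field.absoluteGaloisGroup ℚ),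
            ∀ P : WeierstrassCurve.geomTorsion W ((3 : ℕ) : ℤ), g • P - P ∈ Φ)))
  · exact leopoldtKernelAtThree_of_not_hasCM_of_frameOdd_of_oddK2 hF hL h1 h2 hW hS
      RedSplitControlAtThreeOfFacts.redSplitControlAtThree_proof h5 W hCM hO6 hr hcell.1 hcell.2
  · exact h6 W hCM hO6 hr hcell

end Summit.BirchSwinnertonDyer.BirchSwinnertonDyer.Theorems

end
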